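import Literature.Probability.Percolation.ZdFourArmSepInwardExt
import HarnessLib

/-!
# Inward extension of Kesten's well-separated four-arm event (bond percolation on `ℤ²`), probabilistic half

Topic `Literature/Probability/Percolation`; critical bond percolation on `ℤ²`
(`bondPercolation (zdGraph 2) half`). Proofs and two auxiliary pair-set definitions (no named fact).

The **extension cost of the fully fenced four-arm event `zdFourArmSep` when the inner radius is
halved** (P. Nolin, EJP 13 (2008), §4.3 Prop. 12 (i) [arXiv 0711.4948: Prop. 11 (i)] "once
well-separated, the arms can easily be extended", used in §4.4 part 2 "Internal extremities": "for
the size `η'₀`, going from `∂S_m` to `∂S_{2m}` has a cost `C'₀` depending only on `η'₀`"; H. Kesten,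
CMP 109 (1987), §2, Lemma 5 with (2.43)):

  `c¹⁶ · P_{1/2}(zdFourArmSep m N) ≤ P_{1/2}(zdFourArmSep m' N)`   (`64 ≤ m'`, `2m' ≤ m ≤ 4m'`, `2m ≤ N`),

`c = c(256) > 0` the RSW constant (`rsw_lowerBound_holds 256`), whence
`P(zdFourArmSep m N) ≤ C₀ P(zdFourArmSep m' N)` with `C₀ = c⁻¹⁶` — the hypothesis `hext` of the inward
multi-scale summation `real_fourArmTwoClusters_le_mul_of_scheme_inner` (`ZdFourArmSeparationStep.lean`)
run on the fenced events, i.e. one of the four inputs of the INTERNAL half of Kesten's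
arm-separation theorem for bond percolation on `ℤ²` (the missing input of
`DuminilCopinManolescuTassion2021_zdFourArm_quasiMult_of_wellSeparated`,
`ZdFourArmQuasiMultOfSeparation.lean`).  The deterministic half is
`mem_zdFourArmSep_of_mem_inward` (`ZdFourArmSepInwardExt.lean`); here:

* `inwardOpenPairs m m'`, `inwardDualPairs m m'` — the pairs read by the sixteen extension events
  (`determinedBy_inwardOpenEvents`, `determinedBy_inwardDualEvents`), their sites
  (`inwardOpenPairs_sites`, `inwardDualPairs_sites`: open sites have `|x₁| ≤ 2·m'/64`,
  `m' - m'/8 + 1 ≤ |x₀| ≤ m - 1`; dual sites have `|x₀| ≤ 2·m'/64 + 1`, `m' - m'/8 ≤ |x₁| ≤ m - 1`),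
  `disjoint_inwardPairs`;
* `le_real_inwardOpenEvents`, `le_real_inwardDualEvents` — RSW and Harris: each class has probability
  `≥ c⁸` (all sixteen rectangles have aspect ratio `≤ 256` when `m ≤ 4m'`);
* `real_zdFourArmSep_inter_inward_ge` — the generalised FKG inequality
  `bondPercolation_locallyMonotone_fkg` (Nolin 2008, Lemma 13 [arXiv Lemma 12]) with the common
  class `S` = pairs of the zones of `zdFourArmSep m N` (`zdSepZoneR/L/T/B`, all sites of sup-norm
  `≥ m - m/8 - 1` in the relevant coordinate) minus the extension pairs, the increasing class `P` =
  open extension pairs and the decreasing class `M` = dual extension pairs (both inside `B(m-1)`,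
  near the `x`- resp. `y`-axis, disjoint from each other and from the zones of the other colour):
  `c¹⁶ · P(zdFourArmSep m N) ≤ P(zdFourArmSep m N ∩ (inwardOpenEvents m m' ∩ inwardDualEvents m m'))`;
* **`real_zdFourArmSep_inward_ge`**, **`exists_real_zdFourArmSep_le_mul_inward`** — the display and
  its packaged form `∃ C₀ ≥ 1, P(zdFourArmSep m N) ≤ C₀ · P(zdFourArmSep m' N)`.

## References

* P. Nolin, *Near-critical percolation in two dimensions*, EJP 13 (2008), §4.3 Prop. 12 (i) and
  Lemma 13, §4.4 part 2 [arXiv 0711.4948: Prop. 11 (i), Lemma 12, p. 13]. [Nolin2008]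
* H. Kesten, *Scaling relations for 2D-percolation*, CMP 109 (1987), §2, Lemma 5, (2.43).
  [KestenScalingCMP1987]
* B. Bollobás, O. Riordan, *Percolation* (2006), Ch. 3, eq. (3) (RSW). [BollobasRiordan2006]

Tree: `mem_zdFourArmSep_of_mem_inward`, `inwardOpenEvents`, `inwardDualEvents`,
`dualLRFaceCrossing(Pairs)`, `le_real_dualLRFaceCrossing_of_rsw_ratio`, `le_real_tbCrossingAt'_of_rsw_ratio`
(`ZdFourArmSepInwardExt.lean`); `bondPercolation_locallyMonotone_fkg` (`BondLocallyMonotoneFKG.lean`);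
`gl_zone_small_box`, `coords_of_mem_sqAnnulus`, `le_real_inter4_of_upper/lower`,
`le_real_lrCrossingAt_of_rsw_ratio`, `le_real_dualFaceCrossing_of_rsw_ratio`, `sym2_subset_coe_sym2`
(`ZdFourArmSepGlueProb.lean`); `determinedBy_zdSepOpenArmR/L`, `determinedBy_zdSepDualArmT/B`,
`zdSepZoneR/L/T/B` (`ZdFiveArmSeparatedGluing.lean`, `ZdFourArmSeparated.lean`); `rsw_lowerBound_holds`
(`RSWLemma.lean`).
-/

noncomputable section

open MeasureTheory Set SimpleGraph

namespace Literature.Probability.Percolation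

open LatticeModels

/-! ### The pairs read by the extension events -/

section Pairs

/-- The pairs read by the eight open extension events: pairs of sites of their eight rectangles.
[folklore] -/
def inwardOpenPairs (m m' : ℕ) : Finset (Sym2 (Site 2)) :=
  (((rectangle (m - 1 - m') (m' / 64)).image (· + (![(m' : ℤ), 0] : Site 2))).sym2 ∪
      ((rectangle (m' / 8 - 1 + m' / 16) (m' / 64)).image (· + (![(m' : ℤ) - (m' / 8 : ℕ) + 1, 0] : Site 2))).sym2 ∪
    (((rectangle (m' / 16 - 1) (3 * (m' / 64))).image (· + (![(m' : ℤ) + 1, -((m' / 64 : ℕ) : ℤ)] : Site 2))).sym2 ∪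
      ((rectangle (m' / 8 - 2) (3 * (m' / 64))).image (· + (![(m' : ℤ) - (m' / 8 : ℕ) + 1, -((m' / 64 : ℕ) : ℤ)] : Site 2))).sym2)) ∪
  (((rectangle (m - 1 - m') (m' / 64)).image (· + (![-((m : ℤ) - 1), 0] : Site 2))).sym2 ∪
      ((rectangle (m' / 8 - 1 + m' / 16) (m' / 64)).image (· + (![-((m' : ℤ) + (m' / 16 : ℕ)), 0] : Site 2))).sym2 ∪
    (((rectangle (m' / 16 - 1) (3 * (m' / 64))).image (· + (![-((m' : ℤ) + (m' / 16 : ℕ)), -((m' / 64 : ℕ) : ℤ)] : Site 2))).sym2 ∪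
      ((rectangle (m' / 8 - 2) (3 * (m' / 64))).image (· + (![-(m' : ℤ) + 1, -((m' / 64 : ℕ) : ℤ)] : Site 2))).sym2))

/-- The pairs read by the eight closed-dual extension events. [folklore] -/
def inwardDualPairs (m m' : ℕ) : Finset (Sym2 (Site 2)) :=
  (dualFaceCrossingPairs ![0, (m' : ℤ)] (m' / 64 + 1) (m - 2 - m') ∪
      dualLRFaceCrossingPairs ![-((m' / 64 : ℕ) : ℤ), (m' : ℤ)] (3 * (m' / 64)) (m' / 16 - 1) ∪
    (dualFaceCrossingPairs ![0, (m' : ℤ) - (m' / 8 : ℕ) + 1] (m' / 64 + 1) (m' / 16 + m' / 8 - 2) ∪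
      dualLRFaceCrossingPairs ![-((m' / 64 : ℕ) : ℤ), (m' : ℤ) - (m' / 8 : ℕ)] (3 * (m' / 64)) (m' / 8 - 2))) ∪
  (dualFaceCrossingPairs ![0, -(m : ℤ) + 2] (m' / 64 + 1) (m - 2 - m') ∪
      dualLRFaceCrossingPairs ![-((m' / 64 : ℕ) : ℤ), -(m' : ℤ) - (m' / 16 : ℕ) + 1] (3 * (m' / 64)) (m' / 16 - 2) ∪
    (dualFaceCrossingPairs ![0, -(m' : ℤ) - (m' / 16 : ℕ) + 2] (m' / 64 + 1) (m' / 16 + m' / 8 - 3) ∪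
      dualLRFaceCrossingPairs ![-((m' / 64 : ℕ) : ℤ), -(m' : ℤ) + 1] (3 * (m' / 64)) (m' / 8 - 2)))

variable {m m' : ℕ}

/-- **Sites of the open extension pairs**: `|x₁| ≤ 2·m'/64` and `m' - m'/8 + 1 ≤ |x₀| ≤ m - 1`.
[folklore] -/
theorem inwardOpenPairs_sites (hm' : 64 ≤ m') (h2 : 2 * m' ≤ m) {e : Sym2 (Site 2)}
    (he : e ∈ inwardOpenPairs m m') {x : Site 2} (hx : x ∈ e) :
    |x 1| ≤ 2 * ((m' / 64 : ℕ) : ℤ) ∧ (m' : ℤ) - (m' / 8 : ℕ) + 1 ≤ |x 0| ∧ |x 0| + 1 ≤ m := by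
  simp only [inwardOpenPairs, Finset.mem_union] at he
  rcases he with ((he | he) | (he | he)) | ((he | he) | (he | he)) <;>
    have h := apply_le_of_mem_rectanglePairs he hx <;>
    simp only [Matrix.cons_val_zero, Matrix.cons_val_one] at h <;>
    (first
      | exact ⟨abs_le.2 ⟨by omega, by omega⟩, by rw [abs_of_nonneg (by omega)]; omega,
          by rw [abs_of_nonneg (by omega)]; omega⟩
      | exact ⟨abs_le.2 ⟨by omega, by omega⟩, by rw [abs_of_nonpos (by omega)]; omega,
          by rw [abs_of_nonpos (by omega)]; omega⟩)

/-- **Sites of the dual extension pairs**: `|x₀| ≤ 2·m'/64 + 1` and `m' - m'/8 ≤ |x₁| ≤ m - 1`.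
[folklore] -/
theorem inwardDualPairs_sites (hm' : 64 ≤ m') (h2 : 2 * m' ≤ m) {e : Sym2 (Site 2)}
    (he : e ∈ inwardDualPairs m m') {x : Site 2} (hx : x ∈ e) :
    |x 0| ≤ 2 * ((m' / 64 : ℕ) : ℤ) + 1 ∧ (m' : ℤ) - (m' / 8 : ℕ) ≤ |x 1| ∧ |x 1| + 1 ≤ m := by
  simp only [inwardDualPairs, Finset.mem_union] at he
  rcases he with ((he | he) | (he | he)) | ((he | he) | (he | he)) <;>
    [have h := apply_le_of_mem_dualFaceCrossingPairs he hx;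
      have h := apply_le_of_mem_dualLRFaceCrossingPairs he hx;
      have h := apply_le_of_mem_dualFaceCrossingPairs he hx;
      have h := apply_le_of_mem_dualLRFaceCrossingPairs he hx;
      have h := apply_le_of_mem_dualFaceCrossingPairs he hx;
      have h := apply_le_of_mem_dualLRFaceCrossingPairs he hx;
      have h := apply_le_of_mem_dualFaceCrossingPairs he hx;
      have h := apply_le_of_mem_dualLRFaceCrossingPairs he hx] <;>
    simp only [Matrix.cons_val_zero, Matrix.cons_val_one] at h <;>
    (first
      | exact ⟨abs_le.2 ⟨by omega, by omega⟩, by rw [abs_of_nonneg (by omega)]; omega,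
          by rw [abs_of_nonneg (by omega)]; omega⟩
      | exact ⟨abs_le.2 ⟨by omega, by omega⟩, by rw [abs_of_nonpos (by omega)]; omega,
          by rw [abs_of_nonpos (by omega)]; omega⟩)

/-- The open and dual extension pairs are disjoint (open sites have `|x₀| ≥ m' - m'/8 + 1 > 2·m'/64 + 1`).
[folklore] -/
theorem disjoint_inwardPairs (hm' : 64 ≤ m') (h2 : 2 * m' ≤ m) :
    Disjoint (inwardOpenPairs m m') (inwardDualPairs m m') := by
  rw [Finset.disjoint_left]
  intro e heP heM
  obtain ⟨x, hx⟩ : ∃ x, x ∈ e := ⟨e.out.1, Sym2.out_fst_mem e⟩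
  have h1 := inwardOpenPairs_sites hm' h2 heP hx
  have h2' := inwardDualPairs_sites hm' h2 heM hx
  omega

/-- The open extension events are determined by the open extension pairs. [folklore] -/
theorem determinedBy_inwardOpenEvents (m m' : ℕ) :
    DeterminedBy (inwardOpenEvents m m') ↑(inwardOpenPairs m m') := by
  unfold inwardOpenEvents inwardOpenPairs
  exact (((determinedBy_openCrossing_image _ _ _ _).inter_finsetUnion (determinedBy_openCrossing_image _ _ _ _)).inter_finsetUnion
    ((determinedBy_openCrossing_image _ _ _ _).inter_finsetUnion (determinedBy_openCrossing_image _ _ _ _))).inter_finsetUnion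
    (((determinedBy_openCrossing_image _ _ _ _).inter_finsetUnion (determinedBy_openCrossing_image _ _ _ _)).inter_finsetUnion
      ((determinedBy_openCrossing_image _ _ _ _).inter_finsetUnion (determinedBy_openCrossing_image _ _ _ _)))

/-- The dual extension events are determined by the dual extension pairs. [folklore] -/
theorem determinedBy_inwardDualEvents (m m' : ℕ) :
    DeterminedBy (inwardDualEvents m m') ↑(inwardDualPairs m m') := by
  unfold inwardDualEvents inwardDualPairs
  exact (((determinedBy_dualFaceCrossing _ _ _).inter_finsetUnion (determinedBy_dualLRFaceCrossing _ _ _)).inter_finsetUnion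
    ((determinedBy_dualFaceCrossing _ _ _).inter_finsetUnion (determinedBy_dualLRFaceCrossing _ _ _))).inter_finsetUnion
    (((determinedBy_dualFaceCrossing _ _ _).inter_finsetUnion (determinedBy_dualLRFaceCrossing _ _ _)).inter_finsetUnion
      ((determinedBy_dualFaceCrossing _ _ _).inter_finsetUnion (determinedBy_dualLRFaceCrossing _ _ _)))

/-- The open extension events are increasing. [folklore] -/
theorem isUpperSet_inwardOpenEvents (m m' : ℕ) : IsUpperSet (inwardOpenEvents m m') :=
  (((isUpperSet_lrCrossingAt _ _ _).inter (isUpperSet_lrCrossingAt _ _ _)).inter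
    ((isUpperSet_tbCrossingAt' _ _ _).inter (isUpperSet_tbCrossingAt' _ _ _))).inter
    (((isUpperSet_lrCrossingAt _ _ _).inter (isUpperSet_lrCrossingAt _ _ _)).inter
      ((isUpperSet_tbCrossingAt' _ _ _).inter (isUpperSet_tbCrossingAt' _ _ _)))

/-- The dual extension events are decreasing. [folklore] -/
theorem isLowerSet_inwardDualEvents (m m' : ℕ) : IsLowerSet (inwardDualEvents m m') :=
  (((isLowerSet_dualFaceCrossing _ _ _).inter (isLowerSet_dualLRFaceCrossing _ _ _)).inter
    ((isLowerSet_dualFaceCrossing _ _ _).inter (isLowerSet_dualLRFaceCrossing _ _ _))).inter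
    (((isLowerSet_dualFaceCrossing _ _ _).inter (isLowerSet_dualLRFaceCrossing _ _ _)).inter
      ((isLowerSet_dualFaceCrossing _ _ _).inter (isLowerSet_dualLRFaceCrossing _ _ _)))

end Pairs

/-! ### RSW and Harris: each class of extension events has probability `≥ c⁸` -/

section RSW

variable {m m' : ℕ} {c : ℝ}

/-- **The open extension events have probability `≥ c⁸`** (`c` the RSW constant at aspect ratio
`256`; `64 ≤ m'`, `m ≤ 4m'`). [cite: BollobasRiordan2006, Ch. 3, eq. (3)] -/
theorem le_real_inwardOpenEvents (hc0 : 0 < c)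
    (hc : ∀ l : ℕ, 1 ≤ l → c ≤ crossingProb half (256 * l - 1) (l - 1)) (hm' : 64 ≤ m') (h4 : m ≤ 4 * m') :
    c ^ 8 ≤ (bondPercolation (zdGraph 2) half).real (inwardOpenEvents m m') := by
  have hc0' := hc0.le
  have e : c ^ 8 = c ^ 4 * c ^ 4 := by ring
  rw [e, inwardOpenEvents]
  refine le_real_inter_of_upper (by positivity) (by positivity)
    (((isUpperSet_lrCrossingAt _ _ _).inter (isUpperSet_lrCrossingAt _ _ _)).inter
      ((isUpperSet_tbCrossingAt' _ _ _).inter (isUpperSet_tbCrossingAt' _ _ _)))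
    (((isUpperSet_lrCrossingAt _ _ _).inter (isUpperSet_lrCrossingAt _ _ _)).inter
      ((isUpperSet_tbCrossingAt' _ _ _).inter (isUpperSet_tbCrossingAt' _ _ _)))
    (((measurableSet_lrCrossingAt _ _ _).inter (measurableSet_lrCrossingAt _ _ _)).inter
      ((measurableSet_tbCrossingAt' _ _ _).inter (measurableSet_tbCrossingAt' _ _ _)))
    (((measurableSet_lrCrossingAt _ _ _).inter (measurableSet_lrCrossingAt _ _ _)).inter
      ((measurableSet_tbCrossingAt' _ _ _).inter (measurableSet_tbCrossingAt' _ _ _))) ?_ ?_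
  · exact le_real_inter4_of_upper hc0' (isUpperSet_lrCrossingAt _ _ _) (isUpperSet_lrCrossingAt _ _ _)
      (isUpperSet_tbCrossingAt' _ _ _) (isUpperSet_tbCrossingAt' _ _ _) (measurableSet_lrCrossingAt _ _ _)
      (measurableSet_lrCrossingAt _ _ _) (measurableSet_tbCrossingAt' _ _ _) (measurableSet_tbCrossingAt' _ _ _)
      (le_real_lrCrossingAt_of_rsw_ratio hc _ (by omega)) (le_real_lrCrossingAt_of_rsw_ratio hc _ (by omega))
      (le_real_tbCrossingAt'_of_rsw_ratio hc _ (by omega)) (le_real_tbCrossingAt'_of_rsw_ratio hc _ (by omega))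
  · exact le_real_inter4_of_upper hc0' (isUpperSet_lrCrossingAt _ _ _) (isUpperSet_lrCrossingAt _ _ _)
      (isUpperSet_tbCrossingAt' _ _ _) (isUpperSet_tbCrossingAt' _ _ _) (measurableSet_lrCrossingAt _ _ _)
      (measurableSet_lrCrossingAt _ _ _) (measurableSet_tbCrossingAt' _ _ _) (measurableSet_tbCrossingAt' _ _ _)
      (le_real_lrCrossingAt_of_rsw_ratio hc _ (by omega)) (le_real_lrCrossingAt_of_rsw_ratio hc _ (by omega))
      (le_real_tbCrossingAt'_of_rsw_ratio hc _ (by omega)) (le_real_tbCrossingAt'_of_rsw_ratio hc _ (by omega))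

/-- **The dual extension events have probability `≥ c⁸`.** [cite: BollobasRiordan2006, Ch. 3, eq. (3) and Cor. 3(i)] -/
theorem le_real_inwardDualEvents (hc0 : 0 < c)
    (hc : ∀ l : ℕ, 1 ≤ l → c ≤ crossingProb half (256 * l - 1) (l - 1)) (hm' : 64 ≤ m') (h4 : m ≤ 4 * m') :
    c ^ 8 ≤ (bondPercolation (zdGraph 2) half).real (inwardDualEvents m m') := by
  have hc0' := hc0.le
  have e : c ^ 8 = c ^ 4 * c ^ 4 := by ring
  rw [e, inwardDualEvents]
  refine le_real_inter_of_lower (by positivity) (by positivity)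
    (((isLowerSet_dualFaceCrossing _ _ _).inter (isLowerSet_dualLRFaceCrossing _ _ _)).inter
      ((isLowerSet_dualFaceCrossing _ _ _).inter (isLowerSet_dualLRFaceCrossing _ _ _)))
    (((isLowerSet_dualFaceCrossing _ _ _).inter (isLowerSet_dualLRFaceCrossing _ _ _)).inter
      ((isLowerSet_dualFaceCrossing _ _ _).inter (isLowerSet_dualLRFaceCrossing _ _ _)))
    (((measurableSet_dualFaceCrossing _ _ _).inter (measurableSet_dualLRFaceCrossing _ _ _)).inter
      ((measurableSet_dualFaceCrossing _ _ _).inter (measurableSet_dualLRFaceCrossing _ _ _)))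
    (((measurableSet_dualFaceCrossing _ _ _).inter (measurableSet_dualLRFaceCrossing _ _ _)).inter
      ((measurableSet_dualFaceCrossing _ _ _).inter (measurableSet_dualLRFaceCrossing _ _ _))) ?_ ?_
  · exact le_real_inter4_of_lower hc0' (isLowerSet_dualFaceCrossing _ _ _) (isLowerSet_dualLRFaceCrossing _ _ _)
      (isLowerSet_dualFaceCrossing _ _ _) (isLowerSet_dualLRFaceCrossing _ _ _) (measurableSet_dualFaceCrossing _ _ _)
      (measurableSet_dualLRFaceCrossing _ _ _) (measurableSet_dualFaceCrossing _ _ _) (measurableSet_dualLRFaceCrossing _ _ _)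
      (le_real_dualFaceCrossing_of_rsw_ratio hc _ (by omega)) (le_real_dualLRFaceCrossing_of_rsw_ratio hc _ (by omega))
      (le_real_dualFaceCrossing_of_rsw_ratio hc _ (by omega)) (le_real_dualLRFaceCrossing_of_rsw_ratio hc _ (by omega))
  · exact le_real_inter4_of_lower hc0' (isLowerSet_dualFaceCrossing _ _ _) (isLowerSet_dualLRFaceCrossing _ _ _)
      (isLowerSet_dualFaceCrossing _ _ _) (isLowerSet_dualLRFaceCrossing _ _ _) (measurableSet_dualFaceCrossing _ _ _)
      (measurableSet_dualLRFaceCrossing _ _ _) (measurableSet_dualFaceCrossing _ _ _) (measurableSet_dualLRFaceCrossing _ _ _)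
      (le_real_dualFaceCrossing_of_rsw_ratio hc _ (by omega)) (le_real_dualLRFaceCrossing_of_rsw_ratio hc _ (by omega))
      (le_real_dualFaceCrossing_of_rsw_ratio hc _ (by omega)) (le_real_dualLRFaceCrossing_of_rsw_ratio hc _ (by omega))

end RSW

/-! ### The generalised FKG inequality and the extension cost -/

section Main

variable {m m' N : ℕ} {c : ℝ}

/-- A site of a dual extension pair lies in no right/left zone of `zdFourArmSep m N`. [folklore] -/
theorem notMem_zoneRL_of_dualSite (hm' : 64 ≤ m') (h2 : 2 * m' ≤ m) (hN : 2 * m ≤ N) {x : Site 2}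
    (hx : |x 0| ≤ 2 * ((m' / 64 : ℕ) : ℤ) + 1 ∧ (m' : ℤ) - (m' / 8 : ℕ) ≤ |x 1| ∧ |x 1| + 1 ≤ m) :
    x ∉ zdSepZoneR m N ∪ zdSepZoneL m N := by
  have a0 := abs_le.1 hx.1
  have b1 := abs_le.1 (show |x 1| ≤ (m : ℤ) - 1 by omega)
  have e1 : 2 * (m' / 64) + 2 + m / 8 ≤ m := by omega
  have e1' : 2 * ((m' / 64 : ℕ) : ℤ) + 2 + (m / 8 : ℕ) ≤ m := by exact_mod_cast e1
  rintro (h | h)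
  · rcases h with h | ⟨h0, h0', h1'⟩ | ⟨h0, h0', h1'⟩
    · have := coords_of_mem_sqAnnulus (by omega) h; omega
    · omega
    · omega
  · rcases h with h | ⟨h0, h0', h1'⟩ | ⟨h0, h0', h1'⟩
    · have := coords_of_mem_sqAnnulus (by omega) h; omega
    · omega
    · omega

/-- A site of an open extension pair lies in no top/bottom zone of `zdFourArmSep m N`. [folklore] -/
theorem notMem_zoneTB_of_openSite (hm' : 64 ≤ m') (h2 : 2 * m' ≤ m) (hN : 2 * m ≤ N) {x : Site 2}
    (hx : |x 1| ≤ 2 * ((m' / 64 : ℕ) : ℤ) ∧ (m' : ℤ) - (m' / 8 : ℕ) + 1 ≤ |x 0| ∧ |x 0| + 1 ≤ m) :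
    x ∉ zdSepZoneT m N ∪ zdSepZoneB m N := by
  have a1 := abs_le.1 hx.1
  have b0 := abs_le.1 (show |x 0| ≤ (m : ℤ) - 1 by omega)
  have e1 : 2 * (m' / 64) + 2 + m / 8 ≤ m := by omega
  have e1' : 2 * ((m' / 64 : ℕ) : ℤ) + 2 + (m / 8 : ℕ) ≤ m := by exact_mod_cast e1
  rintro (h | h)
  · rcases h with h | ⟨h0, h0', h1, h1'⟩ | ⟨h0, h0', h1, h1'⟩
    · have := coords_of_mem_sqAnnulus (by omega) h; omega
    · omega
    · omega
  · rcases h with h | ⟨h0, h0', h1, h1'⟩ | ⟨h0, h0', h1, h1'⟩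
    · have := coords_of_mem_sqAnnulus (by omega) h; omega
    · omega
    · omega

/-- **Inward extension, the generalised FKG step** (Nolin 2008, Lemma 13 [arXiv Lemma 12] applied to
the well-separated event of `A_{m,N}` — an increasing event meet a decreasing one, read off the
pairs of its zones — and the sixteen extension events inside `B(m-1)`): for `64 ≤ m'`,
`2m' ≤ m ≤ 4m'`, `2m ≤ N` and the RSW constant `c` at aspect ratio `256`,
`c¹⁶ · P(zdFourArmSep m N) ≤ P(zdFourArmSep m N ∩ (inwardOpenEvents m m' ∩ inwardDualEvents m m'))`.
[cite: Nolin2008, §4.3 Prop. 12 (i) and Lemma 13 (arXiv 0711.4948: Prop. 11 (i), Lemma 12)] [cite: KestenScalingCMP1987, §2 Lemma 5, (2.43)] -/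
theorem real_zdFourArmSep_inter_inward_ge (hm' : 64 ≤ m') (h2 : 2 * m' ≤ m) (h4 : m ≤ 4 * m')
    (hN : 2 * m ≤ N) (hc0 : 0 < c) (hc : ∀ l : ℕ, 1 ≤ l → c ≤ crossingProb half (256 * l - 1) (l - 1)) :
    c ^ 16 * (bondPercolation (zdGraph 2) half).real (zdFourArmSep m N) ≤
      (bondPercolation (zdGraph 2) half).real
        (zdFourArmSep m N ∩ (inwardOpenEvents m m' ∩ inwardDualEvents m m')) := by
  classical
  set μ := bondPercolation (zdGraph 2) half with hμ
  set P : Finset (Sym2 (Site 2)) := inwardOpenPairs m m' with hP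
  set M : Finset (Sym2 (Site 2)) := inwardDualPairs m m' with hM
  set Z : Set (Site 2) := zdSepZoneR m N ∪ zdSepZoneL m N ∪ (zdSepZoneT m N ∪ zdSepZoneB m N) with hZ
  set ZS : Finset (Site 2) := (box 2 (N + N / 8 + 1)).filter (· ∈ Z) with hZS
  set S : Finset (Sym2 (Site 2)) := ZS.sym2 \ (P ∪ M) with hS
  have hSP : Disjoint S P := disjoint_sdiff_self_left.mono_right le_sup_left
  have hSM : Disjoint S M := disjoint_sdiff_self_left.mono_right le_sup_right
  have hPM : Disjoint P M := disjoint_inwardPairs hm' h2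
  have hZS_mem : ∀ x ∈ Z, x ∈ ZS := fun x hx => by
    rw [hZS, Finset.mem_filter]
    exact ⟨gl_zone_small_box (by omega) hN hx, hx⟩
  have hRL : (zdSepZoneR m N).sym2 ∪ (zdSepZoneL m N).sym2 ⊆ (↑S ∪ ↑P : Set (Sym2 (Site 2))) := by
    intro e he
    have hz : ∀ x ∈ e, x ∈ zdSepZoneR m N ∪ zdSepZoneL m N := fun x hx => by
      rcases he with he | he
      · exact Or.inl (Set.mem_sym2_iff_subset.1 he hx)
      · exact Or.inr (Set.mem_sym2_iff_subset.1 he hx)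
    by_cases heP : e ∈ P
    · exact Or.inr heP
    · left
      rw [Finset.mem_coe, hS, Finset.mem_sdiff, Finset.mem_union, Finset.mem_sym2_iff]
      refine ⟨fun x hx => hZS_mem x (Or.inl (hz x hx)), ?_⟩
      rintro (h | h)
      · exact heP h
      · obtain ⟨x, hx⟩ : ∃ x, x ∈ e := ⟨e.out.1, Sym2.out_fst_mem e⟩
        exact notMem_zoneRL_of_dualSite hm' h2 hN (inwardDualPairs_sites hm' h2 h hx) (hz x hx)
  have hTB : (zdSepZoneT m N).sym2 ∪ (zdSepZoneB m N).sym2 ⊆ (↑S ∪ ↑M : Set (Sym2 (Site 2))) := by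
    intro e he
    have hz : ∀ x ∈ e, x ∈ zdSepZoneT m N ∪ zdSepZoneB m N := fun x hx => by
      rcases he with he | he
      · exact Or.inl (Set.mem_sym2_iff_subset.1 he hx)
      · exact Or.inr (Set.mem_sym2_iff_subset.1 he hx)
    by_cases heM : e ∈ M
    · exact Or.inr heM
    · left
      rw [Finset.mem_coe, hS, Finset.mem_sdiff, Finset.mem_union, Finset.mem_sym2_iff]
      refine ⟨fun x hx => hZS_mem x (Or.inr (hz x hx)), ?_⟩
      rintro (h | h)
      · obtain ⟨x, hx⟩ : ∃ x, x ∈ e := ⟨e.out.1, Sym2.out_fst_mem e⟩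
        exact notMem_zoneTB_of_openSite hm' h2 hN (inwardOpenPairs_sites hm' h2 h hx) (hz x hx)
      · exact heM h
  have dAp : DeterminedBy (zdSepOpenArmR m N ∩ zdSepOpenArmL m N) (↑S ∪ ↑P) :=
    (determinedBy_zdSepOpenArmR fun e he => hRL (Or.inl he)).inter
      (determinedBy_zdSepOpenArmL fun e he => hRL (Or.inr he))
  have dAm : DeterminedBy (zdSepDualArmT m N ∩ zdSepDualArmB m N) (↑S ∪ ↑M) :=
    (determinedBy_zdSepDualArmT fun e he => hTB (Or.inl he)).inter
      (determinedBy_zdSepDualArmB fun e he => hTB (Or.inr he))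
  have dBp : DeterminedBy (inwardOpenEvents m m') ↑P := determinedBy_inwardOpenEvents m m'
  have dBm : DeterminedBy (inwardDualEvents m m') ↑M := determinedBy_inwardDualEvents m m'
  have hFKG := bondPercolation_locallyMonotone_fkg (zdGraph 2) half hSP hSM hPM
    (isUpperSet_zdSepOpenArmR_inter_zdSepOpenArmL m N)
    ((isLowerSet_zdSepDualArmT _ _).inter (isLowerSet_zdSepDualArmB _ _))
    (isUpperSet_inwardOpenEvents m m') (isLowerSet_inwardDualEvents m m') dAp dAm dBp dBm
  have hBp := le_real_inwardOpenEvents hc0 hc hm' h4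
  have hBm := le_real_inwardDualEvents hc0 hc hm' h4
  have hset : zdSepOpenArmR m N ∩ zdSepOpenArmL m N ∩ (zdSepDualArmT m N ∩ zdSepDualArmB m N) =
      zdFourArmSep m N := rfl
  rw [hset] at hFKG
  calc c ^ 16 * μ.real (zdFourArmSep m N)
      = μ.real (zdFourArmSep m N) * (c ^ 8 * c ^ 8) := by ring
    _ ≤ μ.real (zdFourArmSep m N) * (μ.real (inwardOpenEvents m m') * μ.real (inwardDualEvents m m')) :=
        mul_le_mul_of_nonneg_left (mul_le_mul hBp hBm (by positivity) measureReal_nonneg) measureReal_nonneg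
    _ ≤ _ := hFKG

/-- **Inward extension of the well-separated four-arm event** (Nolin 2008, Prop. 12 (i), inward;
Kesten 1987, Lemma 5): `c¹⁶ · P(zdFourArmSep m N) ≤ P(zdFourArmSep m' N)` for `64 ≤ m'`,
`2m' ≤ m ≤ 4m'`, `2m ≤ N`, `c` the RSW constant at aspect ratio `256`. [cite: Nolin2008, §4.3 Prop. 12 (i) and §4.4 part 2 (arXiv 0711.4948: Prop. 11 (i), p. 13)] [cite: KestenScalingCMP1987, §2 Lemma 5] -/
theorem real_zdFourArmSep_inward_ge (hm' : 64 ≤ m') (h2 : 2 * m' ≤ m) (h4 : m ≤ 4 * m')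
    (hN : 2 * m ≤ N) (hc0 : 0 < c) (hc : ∀ l : ℕ, 1 ≤ l → c ≤ crossingProb half (256 * l - 1) (l - 1)) :
    c ^ 16 * (bondPercolation (zdGraph 2) half).real (zdFourArmSep m N) ≤
      (bondPercolation (zdGraph 2) half).real (zdFourArmSep m' N) := by
  refine (real_zdFourArmSep_inter_inward_ge hm' h2 h4 hN hc0 hc).trans ?_
  refine ENNReal.toReal_mono (measure_ne_top _ _) (measure_mono_ae ?_)
  have hae : ∀ᵐ ω ∂(bondPercolation (zdGraph 2) half), ω ⊆ (zdGraph 2).edgeSet :=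
    ProbabilityTheory.setBernoulli_ae_subset
  filter_upwards [hae] with ω hω h
  exact mem_zdFourArmSep_of_mem_inward hω hm' h2 hN h

/-- **Extension cost of the well-separated event at halved inner radius**, packaged: there is
`C₀ ≥ 1` with `P(zdFourArmSep m N) ≤ C₀ · P(zdFourArmSep m' N)` whenever `64 ≤ m'`, `2m' ≤ m ≤ 4m'`,
`2m ≤ N` — the hypothesis `hext` of the inward summation of Kesten's scheme
(`real_fourArmTwoClusters_le_mul_of_scheme_inner`). [cite: Nolin2008, §4.4 part 2 (arXiv 0711.4948 p. 13: "going from ∂S_m to ∂S_{2m} has a cost C'₀ depending only on η'₀")] -/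
theorem exists_real_zdFourArmSep_le_mul_inward :
    ∃ C₀ : ℝ, 1 ≤ C₀ ∧ ∀ m m' N : ℕ, 64 ≤ m' → 2 * m' ≤ m → m ≤ 4 * m' → 2 * m ≤ N →
      (bondPercolation (zdGraph 2) half).real (zdFourArmSep m N) ≤
        C₀ * (bondPercolation (zdGraph 2) half).real (zdFourArmSep m' N) := by
  obtain ⟨c, hc0, hc⟩ := rsw_lowerBound_holds 256 (by norm_num)
  refine ⟨max 1 (c ^ 16)⁻¹, le_max_left _ _, fun m m' N hm' h2 h4 hN => ?_⟩
  have h := real_zdFourArmSep_inward_ge hm' h2 h4 hN hc0 hc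
  have hc16 : 0 < c ^ 16 := by positivity
  calc (bondPercolation (zdGraph 2) half).real (zdFourArmSep m N)
      = (c ^ 16)⁻¹ * (c ^ 16 * (bondPercolation (zdGraph 2) half).real (zdFourArmSep m N)) := by
        field_simp
    _ ≤ (c ^ 16)⁻¹ * (bondPercolation (zdGraph 2) half).real (zdFourArmSep m' N) :=
        mul_le_mul_of_nonneg_left h (by positivity)
    _ ≤ max 1 (c ^ 16)⁻¹ * (bondPercolation (zdGraph 2) half).real (zdFourArmSep m' N) :=
        mul_le_mul_of_nonneg_right (le_max_right _ _) measureReal_nonneg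

end Main

end Literature.Probability.Percolation

end
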